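/- WIDTH seat `ym-line-cbag-p1-w3` (prover-ym-line-cbag-p1-w3-g16-0), LINE 7 `GlueballBandRecursion`, in support of ⟨stmt-QuantumFields-22957⟩
`OneParticleBlochSymbolFamily`: Löwdin orthonormalisation, part 2a — the binomial series of `(1 + x)^{-1/2}` in a complete normed algebra
(the analytic engine behind "symmetric orthonormalisation preserves localisation", used by `…LowdinLocalisation`).  Route-independent;
definition-free; a helper. -/
import Mathlib.RingTheory.Binomial
import Mathlib.Analysis.Normed.Ring.InfiniteSum
import Mathlib.Analysis.SpecificLimits.Normed

/-!
# Route `GlueballBandRecursion`, item `OneParticleBlochSymbolFamily` (stmt-QuantumFields-22957): the inverse-square-root series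

For `x` in a complete normed `ℝ`-algebra with `‖x‖ < 1`, the binomial series `r = Σ_k b_k x^k`, `b_k = binom(−1/2, k)`
(`Ring.choose (-(1/2) : ℝ) k`), converges absolutely, satisfies `r·r·(1 + x) = 1 = (1 + x)·r·r` (so `r = (1 + x)^{−1/2}` whenever
square roots are unique), and `‖r − 1‖ ≤ ‖x‖/(1 − ‖x‖)`.  The two scalar inputs: `|b_k| ≤ 1` (`abs_choose_neg_half_le_one`, from the
ratio recurrence `(k+1) b_{k+1} = b_k (−1/2 − k)`) and the Vandermonde convolution `Σ_{i+j=n} b_i b_j = binom(−1, n) = (−1)^n`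
(`sum_antidiagonal_choose_neg_half`, Mathlib's `Ring.add_choose_eq`).  Applied in `…LowdinLocalisation` to the Gram matrix `1 + ε` of a
covariant family of dressed excitations in the row-sum (`ℓ^∞`-operator) norm: the Löwdin weights `(1 + ε)^{−1/2}` inherit the
smallness and the off-diagonal decay of `ε`.

Sources: folklore (Newton's binomial series; Löwdin 1950).  HONEST FRAMING.  Elementary analysis; nothing about item 22957, the rung
`ColdDoublingRecursionStrongCoupling` or the Yang–Mills mass gap is proved or advanced here.
-/

set_option autoImplicit false

noncomputable section

open Finset Filter Topology

namespace Summit.QuantumFields.YangMills.Theorems.GlueballBandRecursion.Lowdin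

/-! ### §1 The binomial coefficients `binom(−1/2, k)` -/

/-- Ratio recurrence of the generalised binomial coefficients over `ℝ`: `(n + 1)·binom(r, n+1) = binom(r, n)·(r − n)`. [folklore] -/
theorem succ_mul_choose_succ (r : ℝ) (n : ℕ) :
    ((n : ℝ) + 1) * Ring.choose r (n + 1) = Ring.choose r n * (r - n) := by
  have h := Ring.choose_smul_choose r (Nat.le_succ n)
  rw [Nat.choose_succ_self_right, show n.succ - n = 1 from by omega, Ring.choose_one_right, nsmul_eq_mul] at h
  push_cast at h
  exact h

/-- `|binom(−1/2, k)| ≤ 1` (the ratios `|−1/2 − k|/(k + 1)` are `≤ 1`). [folklore] -/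
theorem abs_choose_neg_half_le_one (n : ℕ) : |Ring.choose (-(1 / 2 : ℝ)) n| ≤ 1 := by
  induction n with
  | zero => rw [Ring.choose_zero_right, abs_one]
  | succ n ih =>
    have h := succ_mul_choose_succ (-(1 / 2 : ℝ)) n
    have hn : (0 : ℝ) < n + 1 := by positivity
    have h1 : Ring.choose (-(1 / 2 : ℝ)) (n + 1) = Ring.choose (-(1 / 2 : ℝ)) n * (-(1 / 2) - n) / (n + 1) := by
      rw [eq_div_iff hn.ne', mul_comm]
      exact h
    have h2 : |(-(1 / 2 : ℝ)) - n| ≤ n + 1 := by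
      rw [abs_le]
      constructor <;> linarith [n.cast_nonneg (α := ℝ)]
    rw [h1, abs_div, abs_mul, abs_of_pos hn, div_le_one hn]
    calc |Ring.choose (-(1 / 2 : ℝ)) n| * |(-(1 / 2 : ℝ)) - n| ≤ 1 * (n + 1) :=
          mul_le_mul ih h2 (abs_nonneg _) zero_le_one
      _ = n + 1 := one_mul _

/-- **Vandermonde at `−1/2`**: `Σ_{i+j=n} binom(−1/2, i)·binom(−1/2, j) = binom(−1, n) = (−1)^n` — the square of the series of
`(1 + x)^{−1/2}` is the geometric series of `(1 + x)^{−1}`. [folklore] -/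
theorem sum_antidiagonal_choose_neg_half (n : ℕ) :
    ∑ ij ∈ antidiagonal n, Ring.choose (-(1 / 2 : ℝ)) ij.1 * Ring.choose (-(1 / 2 : ℝ)) ij.2 = (-1) ^ n := by
  rw [← Ring.add_choose_eq n (Commute.all _ _), show (-(1 / 2 : ℝ)) + -(1 / 2) = -1 by norm_num, Ring.choose_neg,
    show (1 : ℝ) + n - 1 = n by ring, Ring.choose_natCast, Nat.choose_self, Nat.cast_one, Units.smul_def, zsmul_eq_mul,
    mul_one]
  exact Int.cast_negOnePow_natCast ℝ n

/-! ### §2 The series `Σ_k binom(−1/2, k) x^k` in a complete normed algebra -/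

section Series

variable {A : Type*} [NormedRing A] [NormedAlgebra ℝ A]

/-- Termwise bound `‖b_k x^k‖ ≤ max(1, ‖1‖)·‖x‖^k`. -/
theorem norm_choose_smul_pow_le (x : A) (k : ℕ) :
    ‖Ring.choose (-(1 / 2 : ℝ)) k • x ^ k‖ ≤ max 1 ‖(1 : A)‖ * ‖x‖ ^ k := by
  rcases Nat.eq_zero_or_pos k with rfl | hk
  · rw [Ring.choose_zero_right, one_smul, pow_zero, pow_zero, mul_one]
    exact le_max_right _ _
  · calc ‖Ring.choose (-(1 / 2 : ℝ)) k • x ^ k‖ ≤ ‖Ring.choose (-(1 / 2 : ℝ)) k‖ * ‖x ^ k‖ := norm_smul_le _ _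
      _ ≤ 1 * ‖x‖ ^ k :=
          mul_le_mul (by rw [Real.norm_eq_abs]; exact abs_choose_neg_half_le_one k) (norm_pow_le' x hk)
            (norm_nonneg _) zero_le_one
      _ ≤ max 1 ‖(1 : A)‖ * ‖x‖ ^ k := by
          rw [one_mul]
          exact le_mul_of_one_le_left (pow_nonneg (norm_nonneg _) _) (le_max_left _ _)

/-- For `k ≥ 1` the sharper `‖b_k x^k‖ ≤ ‖x‖^k`. -/
theorem norm_choose_smul_pow_le' (x : A) {k : ℕ} (hk : 0 < k) :
    ‖Ring.choose (-(1 / 2 : ℝ)) k • x ^ k‖ ≤ ‖x‖ ^ k := by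
  calc ‖Ring.choose (-(1 / 2 : ℝ)) k • x ^ k‖ ≤ ‖Ring.choose (-(1 / 2 : ℝ)) k‖ * ‖x ^ k‖ := norm_smul_le _ _
    _ ≤ 1 * ‖x‖ ^ k :=
        mul_le_mul (by rw [Real.norm_eq_abs]; exact abs_choose_neg_half_le_one k) (norm_pow_le' x hk)
          (norm_nonneg _) zero_le_one
    _ = ‖x‖ ^ k := one_mul _

/-- Absolute convergence of the series for `‖x‖ < 1`. -/
theorem summable_norm_choose_smul_pow (x : A) (hx : ‖x‖ < 1) :
    Summable (fun k => ‖Ring.choose (-(1 / 2 : ℝ)) k • x ^ k‖) :=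
  Summable.of_nonneg_of_le (fun _ => norm_nonneg _) (norm_choose_smul_pow_le x)
    ((summable_geometric_of_lt_one (norm_nonneg _) hx).mul_left _)

/-- Each term commutes with `x`, hence so does the series. -/
theorem commute_series (x : A) :
    Commute x (∑' k, Ring.choose (-(1 / 2 : ℝ)) k • x ^ k) :=
  Commute.tsum_right x fun k => ((Commute.refl x).pow_right k).smul_right _

variable [CompleteSpace A]

/-- Convergence of the series for `‖x‖ < 1`. -/
theorem summable_choose_smul_pow (x : A) (hx : ‖x‖ < 1) :
    Summable (fun k => Ring.choose (-(1 / 2 : ℝ)) k • x ^ k) :=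
  (summable_norm_choose_smul_pow x hx).of_norm

/-- **The square of the inverse-square-root series is the geometric series**: `r·r = Σ_n (−x)^n` (Cauchy product + Vandermonde). -/
theorem series_mul_self (x : A) (hx : ‖x‖ < 1) :
    (∑' k, Ring.choose (-(1 / 2 : ℝ)) k • x ^ k) * (∑' k, Ring.choose (-(1 / 2 : ℝ)) k • x ^ k) = ∑' n, (-x) ^ n := by
  rw [tsum_mul_tsum_eq_tsum_sum_antidiagonal_of_summable_norm (summable_norm_choose_smul_pow x hx)
    (summable_norm_choose_smul_pow x hx)]
  refine tsum_congr fun n => ?_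
  have h : ∀ ij ∈ antidiagonal n, (Ring.choose (-(1 / 2 : ℝ)) ij.1 • x ^ ij.1) * (Ring.choose (-(1 / 2 : ℝ)) ij.2 • x ^ ij.2) =
      (Ring.choose (-(1 / 2 : ℝ)) ij.1 * Ring.choose (-(1 / 2 : ℝ)) ij.2) • x ^ n := by
    intro ij hij
    rw [smul_mul_smul_comm, ← pow_add, mem_antidiagonal.1 hij]
  rw [Finset.sum_congr rfl h, ← Finset.sum_smul, sum_antidiagonal_choose_neg_half, ← smul_pow, neg_one_smul]

/-- **`r·r·(1 + x) = 1 = (1 + x)·(r·r)`** for the series `r = Σ_k binom(−1/2, k) x^k`, `‖x‖ < 1`. -/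
theorem series_mul_self_mul_one_add (x : A) (hx : ‖x‖ < 1) :
    (∑' k, Ring.choose (-(1 / 2 : ℝ)) k • x ^ k) * (∑' k, Ring.choose (-(1 / 2 : ℝ)) k • x ^ k) * (1 + x) = 1 ∧
      (1 + x) * ((∑' k, Ring.choose (-(1 / 2 : ℝ)) k • x ^ k) * (∑' k, Ring.choose (-(1 / 2 : ℝ)) k • x ^ k)) = 1 := by
  rw [series_mul_self x hx]
  have h : ‖-x‖ < 1 := by rwa [norm_neg]
  have h1 := geom_series_mul_neg (-x) h
  have h2 := mul_neg_geom_series (-x) h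
  rw [sub_neg_eq_add] at h1 h2
  exact ⟨h1, h2⟩

/-- **Smallness**: `‖r − 1‖ ≤ ‖x‖/(1 − ‖x‖)` (the tail `Σ_{k ≥ 1} ‖x‖^k`). -/
theorem norm_series_sub_one_le (x : A) (hx : ‖x‖ < 1) :
    ‖(∑' k, Ring.choose (-(1 / 2 : ℝ)) k • x ^ k) - 1‖ ≤ ‖x‖ / (1 - ‖x‖) := by
  have hs := summable_choose_smul_pow x hx
  rw [hs.tsum_eq_zero_add, Ring.choose_zero_right, one_smul, pow_zero, add_sub_cancel_left]
  have hg : HasSum (fun k : ℕ => ‖x‖ ^ (k + 1)) (‖x‖ * (1 - ‖x‖)⁻¹) := by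
    have h := (hasSum_geometric_of_lt_one (norm_nonneg x) hx).mul_left ‖x‖
    refine h.congr_fun fun k => ?_
    rw [pow_succ']
  rw [div_eq_mul_inv]
  exact tsum_of_norm_bounded hg fun k => norm_choose_smul_pow_le' x k.succ_pos

end Series

end Summit.QuantumFields.YangMills.Theorems.GlueballBandRecursion.Lowdin

end
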